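import Summits.KontsevichZagierPeriods.Zeta5Search.Barrier.ConeGammaTorus

/-!
# ζ(5) search — BARRIER: the saving term as a Hamiltonian 8-cycle and its Held–Karp dual certificate

HONEST FRAMING (cell `pub-zeta5`): systematic search; no irrationality claim unless kernel-certified. MODEL objects
under Brown–Zudilin's (28)+(30) accounting ([BZ22] = arXiv:2210.03391); nothing here is a statement about `ζ(5)`;
records in print UNMOVED. Infrastructure for the kernel evaluation of the saving rate `Φ(a)` at ONE rational direction
(`BARRIER-PLAN.md` §2b, item (d) «a specific `Φ(a)` in the kernel»; seat P2 g13), part 1/3.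

The obstacle. `N_a(u) = 𝒩(u·s(a))` (`savingN_eq_torusN_of_BZBox`) is a maximum over the `5 040` elements of `S₇`; the
kernel does not evaluate that maximum by enumeration in useful time (measured: one gap does not finish in 60 s).
This file turns the maximum into a statement with a SHORT certificate:

* `floorTab θ i j = ⌊pairForm θ i j⌋` — the integer table of a point `θ ∈ ℝ⁸` (symmetric);
* `tourW`, `tourValF`, `tourVal` — the WEIGHT OF THE HAMILTONIAN 8-CYCLE `0 – σ̃3 – σ̃5 – σ̃4 – σ̃6 – σ̃1 – σ̃7 – σ̃2 – 0`
  in a table `n` (edges at `0` with a minus sign), and **`torusTerm_eq_tourVal`**: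
  `torusTerm θ σ = tourVal (floorTab θ) σ − tourVal (floorTab θ) 1` (the `F^c`/Hamiltonian-path form of
  `ConeGammaTorus.torusTerm_eq_eight`, with floors instead of fractional parts);
* `hkValid n D Y L` — the (kernel-evaluable) test of a HELD–KARP DUAL CERTIFICATE for the table `n`: potentials `Y : Fin 8 → ℤ` and subtour
  multipliers `L : List (List (Fin 8) × ℕ)` (a 2-element set is an edge cap) with
  `D·w(i,j) ≤ Y i + Y j + Σ_{S ∋ i,j} M_S` for all `i ≠ j`; **`tourValF_le_of_hkValid`**: then EVERY Hamiltonian cycle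
  has `D·(weight) ≤ hkBound Y L = 2ΣY + Σ M_S(|S| − 1)` — the subtour inequality `|E(C) ∩ E(S)| ≤ |S| − 1` is
  `cyc_card_lt` (a proper non-empty set of positions on `ℤ/8` has fewer adjacent pairs than elements);
* **`torusN_eq_of_cert`** — if the floor table of `θ` is `n` off the diagonal, `hkValid n D Y L`,
  `hkBound Y L < D(q+1)` and some `σ` attains `tourVal n σ = q`, then `torusN θ = q − tourVal n 1`.
Generic in `θ`; the per-direction tables and certificates are supplied by `ConeGammaGapCert` (part 2/3).
-/

namespace Summit.KontsevichZagierPeriods.Zeta5Search.Barrier.ConeGamma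

open Finset

/-! ### The floor table and the `F^c` form with floors -/

/-- The integer table of a point `θ ∈ ℝ⁸`: `⌊pairForm θ i j⌋`. -/
noncomputable def floorTab (θ : Fin 8 → ℝ) (i j : Fin 8) : ℤ := ⌊pairForm θ i j⌋

/-- The floor table is symmetric. -/
theorem floorTab_comm (θ : Fin 8 → ℝ) (i j : Fin 8) : floorTab θ i j = floorTab θ j i := by
  unfold floorTab; rw [pairForm_comm]

/-- `torusTerm θ σ = Σ_{i∉F} (⌊φ_i(σθ)⌋ − ⌊φ_i(θ)⌋)` (the total of the 28 floors is `S₇`-invariant). -/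
theorem torusTerm_eq_compl_floor (θ : Fin 8 → ℝ) (σ : Equiv.Perm (Fin 7)) :
    torusTerm θ σ = ∑ i ∈ FIdxᶜ, (⌊phiForm (permS σ θ) i⌋ - ⌊phiForm θ i⌋) := by
  have hall := sum_univ_phiForm_permS (fun x => ((⌊x⌋ : ℤ) : ℝ)) σ θ
  have hallZ : ∑ k : Fin 28, ⌊phiForm (permS σ θ) k⌋ = ∑ k : Fin 28, ⌊phiForm θ k⌋ := by
    exact_mod_cast hall
  rw [← Finset.sum_add_sum_compl FIdx, ← Finset.sum_add_sum_compl FIdx (fun k => ⌊phiForm θ k⌋)] at hallZ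
  unfold torusTerm
  simp only [Finset.sum_sub_distrib]
  linarith

/-- `F^c` as an explicit list of eleven indices. -/
theorem compl_FIdx_eq : FIdxᶜ = ({7, 18, 20, 21, 24, 25, 11, 12, 14, 16, 23} : Finset (Fin 28)) := by decide

/-- The eleven floors of `F^c` at `σ·θ`, as table entries. -/
theorem sum_compl_floor_permS (θ : Fin 8 → ℝ) (σ : Equiv.Perm (Fin 7)) :
    ∑ i ∈ FIdxᶜ, ⌊phiForm (permS σ θ) i⌋ =
      floorTab θ (σ 2).succ (σ 4).succ + floorTab θ (σ 3).succ (σ 5).succ + floorTab θ (σ 0).succ (σ 5).succ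
        + floorTab θ (σ 0).succ (σ 6).succ + floorTab θ (σ 3).succ (σ 4).succ + floorTab θ (σ 1).succ (σ 6).succ
        + (floorTab θ 0 (σ 3).succ + floorTab θ 0 (σ 4).succ + floorTab θ 0 (σ 0).succ + floorTab θ 0 (σ 5).succ
            + floorTab θ 0 (σ 6).succ) := by
  rw [compl_FIdx_eq]
  simp [Finset.sum_insert, phiForm_permS, fstIdx, sndIdx, floorTab]
  ring

/-- The five `{0,j}`-floors of `F^c` are the seven minus the two path ends. -/
theorem zero_floors_eq (θ : Fin 8 → ℝ) (σ : Equiv.Perm (Fin 7)) :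
    floorTab θ 0 (σ 3).succ + floorTab θ 0 (σ 4).succ + floorTab θ 0 (σ 0).succ + floorTab θ 0 (σ 5).succ
        + floorTab θ 0 (σ 6).succ
      = (∑ j : Fin 7, floorTab θ 0 j.succ) - floorTab θ 0 (σ 1).succ - floorTab θ 0 (σ 2).succ := by
  rw [← Equiv.sum_comp σ (fun j => floorTab θ 0 j.succ)]
  simp only [Fin.sum_univ_seven]
  ring

/-! ### The Hamiltonian 8-cycle -/

/-- Edge weight of the tour: table entry, with a minus sign on the two edges at `0`. -/
def tourW (n : Fin 8 → Fin 8 → ℤ) (i j : Fin 8) : ℤ := if i = 0 ∨ j = 0 then -n i j else n i j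

/-- The fixed visiting order `0, 3, 5, 4, 6, 1, 7, 2` (vertex `0` followed by the Hamiltonian path
`3–5–4–6–1–7–2` of `ConeGammaTorus.hamIdx`). -/
def tourSeq0 : Fin 8 → Fin 8 := ![0, 3, 5, 4, 6, 1, 7, 2]

/-- Weight of the 8-cycle `f 0 – f 3 – f 5 – f 4 – f 6 – f 1 – f 7 – f 2 – f 0` (explicit eight terms, kernel-evaluable). -/
def tourValF (n : Fin 8 → Fin 8 → ℤ) (f : Fin 8 → Fin 8) : ℤ :=
  tourW n (f 0) (f 3) + tourW n (f 3) (f 5) + tourW n (f 5) (f 4) + tourW n (f 4) (f 6) + tourW n (f 6) (f 1)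
    + tourW n (f 1) (f 7) + tourW n (f 7) (f 2) + tourW n (f 2) (f 0)

/-- The tour value of `σ ∈ S₇`: the cycle `0 – σ̃3 – σ̃5 – σ̃4 – σ̃6 – σ̃1 – σ̃7 – σ̃2 – 0`. -/
def tourVal (n : Fin 8 → Fin 8 → ℤ) (σ : Equiv.Perm (Fin 7)) : ℤ := tourValF n (liftPerm σ)

/-- The tour value written out for `σ ∈ S₇` and a SYMMETRIC table. -/
theorem tourVal_eq (n : Fin 8 → Fin 8 → ℤ) (hn : ∀ i j, n i j = n j i) (σ : Equiv.Perm (Fin 7)) :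
    tourVal n σ = n (σ 2).succ (σ 4).succ + n (σ 3).succ (σ 5).succ + n (σ 0).succ (σ 5).succ
      + n (σ 0).succ (σ 6).succ + n (σ 3).succ (σ 4).succ + n (σ 1).succ (σ 6).succ
      - n 0 (σ 1).succ - n 0 (σ 2).succ := by
  simp only [tourVal, tourValF, tourW, liftPerm_zero, liftPerm_one, liftPerm_two, liftPerm_three, liftPerm_four,
    liftPerm_five, liftPerm_six, liftPerm_seven, Fin.succ_ne_zero, or_false, or_true, if_true, if_false]
  rw [hn (σ 4).succ (σ 3).succ, hn (σ 5).succ (σ 0).succ, hn (σ 6).succ (σ 1).succ, hn (σ 1).succ 0]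
  ring

/-- **`torusTerm θ σ = tourVal(σ) − tourVal(1)`** in the floor table of `θ`. -/
theorem torusTerm_eq_tourVal (θ : Fin 8 → ℝ) (σ : Equiv.Perm (Fin 7)) :
    torusTerm θ σ = tourVal (floorTab θ) σ - tourVal (floorTab θ) 1 := by
  rw [torusTerm_eq_compl_floor, Finset.sum_sub_distrib]
  have h1 := sum_compl_floor_permS θ σ
  have h0 := sum_compl_floor_permS θ 1
  rw [permS_one] at h0
  rw [h1, h0, zero_floors_eq θ σ, zero_floors_eq θ 1, tourVal_eq _ (floorTab_comm θ), tourVal_eq _ (floorTab_comm θ)]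
  simp only [Equiv.Perm.coe_one, id_eq]
  ring

/-- The tour value only reads off-diagonal entries. -/
theorem tourVal_congr {n n' : Fin 8 → Fin 8 → ℤ} (h : ∀ i j, i ≠ j → n i j = n' i j) (σ : Equiv.Perm (Fin 7)) :
    tourVal n σ = tourVal n' σ := by
  have hs : ∀ a b : Fin 7, a ≠ b → (σ a).succ ≠ (σ b).succ := fun a b hab h' =>
    hab (σ.injective (Fin.succ_injective _ h'))
  have hz : ∀ a : Fin 7, (0 : Fin 8) ≠ (σ a).succ := fun a => (Fin.succ_ne_zero _).symm
  have hz' : ∀ a : Fin 7, (σ a).succ ≠ 0 := fun a => Fin.succ_ne_zero _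
  simp only [tourVal, tourValF, tourW, liftPerm_zero, liftPerm_one, liftPerm_two, liftPerm_three, liftPerm_four,
    liftPerm_five, liftPerm_six, liftPerm_seven]
  rw [h _ _ (hz _), h _ _ (hs _ _ (by decide)), h _ _ (hs _ _ (by decide)), h _ _ (hs _ _ (by decide)),
    h _ _ (hs _ _ (by decide)), h _ _ (hs _ _ (by decide)), h _ _ (hs _ _ (by decide)), h _ _ (hz' _)]

/-! ### Held–Karp dual certificates -/

/-- The subtour part of the dual: `Σ_{(S,M) ∈ L, i ∈ S ∧ j ∈ S} M`. -/
def hkSum (L : List (List (Fin 8) × ℕ)) (i j : Fin 8) : ℤ :=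
  (L.map fun p => if i ∈ p.1 ∧ j ∈ p.1 then (p.2 : ℤ) else 0).sum

/-- The dual bound `2 Σ_i Y i + Σ_{(S,M)∈L} M·(|S| − 1)`. -/
def hkBound (Y : Fin 8 → ℤ) (L : List (List (Fin 8) × ℕ)) : ℤ :=
  2 * (Y 0 + Y 1 + Y 2 + Y 3 + Y 4 + Y 5 + Y 6 + Y 7) + (L.map fun p => (p.2 : ℤ) * ((p.1.length : ℤ) - 1)).sum

/-- **Held–Karp dual feasibility** of `(D, Y, L)` for the table `n` (a kernel-evaluable test): every listed
vertex set is a proper non-empty list without repetition, and `D·w(i,j) ≤ Y i + Y j + Σ_{S ∋ i,j} M_S` for all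
`i ≠ j` (`w = tourW n`). -/
def hkValid (n : Fin 8 → Fin 8 → ℤ) (D : ℕ) (Y : Fin 8 → ℤ) (L : List (List (Fin 8) × ℕ)) : Bool :=
  (L.all fun p => decide p.1.Nodup && decide (0 < p.1.length) && decide (p.1.length < 8)) &&
    (List.finRange 8).all fun i => (List.finRange 8).all fun j =>
      decide (i = j) || decide ((D : ℤ) * tourW n i j ≤ Y i + Y j + hkSum L i j)

/-- What a passed test says. -/
theorem hkValid_spec {n : Fin 8 → Fin 8 → ℤ} {D : ℕ} {Y : Fin 8 → ℤ} {L : List (List (Fin 8) × ℕ)}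
    (h : hkValid n D Y L = true) :
    (∀ p ∈ L, p.1.Nodup ∧ 0 < p.1.length ∧ p.1.length < 8) ∧
      ∀ i j : Fin 8, i ≠ j → (D : ℤ) * tourW n i j ≤ Y i + Y j + hkSum L i j := by
  unfold hkValid at h
  simp only [Bool.and_eq_true, List.all_eq_true, decide_eq_true_eq, Bool.or_eq_true] at h
  obtain ⟨hL, hE⟩ := h
  refine ⟨fun p hp => ?_, fun i j hij => ?_⟩
  · obtain ⟨⟨h1, h2⟩, h3⟩ := hL p hp
    exact ⟨h1, h2, h3⟩
  · rcases hE i (List.mem_finRange i) j (List.mem_finRange j) with h | h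
    · exact absurd h hij
    · exact h

/-- **Subtour inequality on `ℤ/8`**: a proper non-empty set of positions has fewer adjacent pairs `(k, k+1)` inside
it than elements. -/
theorem cyc_card_lt (P : Finset (Fin 8)) (hne : P.Nonempty) (hP : P ≠ Finset.univ) :
    (Finset.univ.filter fun k : Fin 8 => k ∈ P ∧ k + 1 ∈ P).card < P.card := by
  set K := Finset.univ.filter fun k : Fin 8 => k ∈ P ∧ k + 1 ∈ P with hK
  have hsub : K.image (· + 1) ⊆ P := by
    intro x hx
    obtain ⟨k, hk, rfl⟩ := Finset.mem_image.mp hx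
    exact (Finset.mem_filter.mp hk).2.2
  have hinj : Set.InjOn (fun k : Fin 8 => k + 1) K := fun a _ b _ h => add_right_cancel h
  have hcard : (K.image (· + 1)).card = K.card := Finset.card_image_of_injOn hinj
  by_contra hlt
  have hle : P.card ≤ (K.image (· + 1)).card := by rw [hcard]; omega
  have heq : K.image (· + 1) = P := Finset.eq_of_subset_of_card_le hsub hle
  have hpred : ∀ p ∈ P, p - 1 ∈ P := by
    intro p hp
    rw [← heq] at hp
    obtain ⟨k, hk, rfl⟩ := Finset.mem_image.mp hp
    have hk' : (fun x : Fin 8 => x + 1) k - 1 = k := by simp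
    rw [hk']
    exact (Finset.mem_filter.mp hk).2.1
  have reach : ∀ a x : Fin 8, x = a ∨ x = a - 1 ∨ x = a - 1 - 1 ∨ x = a - 1 - 1 - 1 ∨ x = a - 1 - 1 - 1 - 1 ∨
      x = a - 1 - 1 - 1 - 1 - 1 ∨ x = a - 1 - 1 - 1 - 1 - 1 - 1 ∨ x = a - 1 - 1 - 1 - 1 - 1 - 1 - 1 := by decide
  obtain ⟨p0, hp0⟩ := hne
  have h1 := hpred _ hp0
  have h2 := hpred _ h1
  have h3 := hpred _ h2
  have h4 := hpred _ h3
  have h5 := hpred _ h4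
  have h6 := hpred _ h5
  have h7 := hpred _ h6
  apply hP
  ext x
  simp only [Finset.mem_univ, iff_true]
  rcases reach p0 x with rfl | rfl | rfl | rfl | rfl | rfl | rfl | rfl <;> assumption

/-- `tourSeq0` is a bijection. -/
theorem tourSeq0_bijective : Function.Bijective tourSeq0 := by decide

/-- `tourSeq0` as a permutation. -/
noncomputable def tourPerm0 : Equiv.Perm (Fin 8) := Equiv.ofBijective tourSeq0 tourSeq0_bijective

/-- The explicit eight terms as a cyclic sum along `c = f ∘ tourSeq0`. -/
theorem tourValF_eq_sum (n : Fin 8 → Fin 8 → ℤ) (f : Fin 8 → Fin 8) :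
    tourValF n f = ∑ k : Fin 8, tourW n (f (tourSeq0 k)) (f (tourSeq0 (k + 1))) := by
  simp only [Fin.sum_univ_eight, tourValF, tourSeq0]
  simp only [Matrix.cons_val_zero, Matrix.cons_val_one, Matrix.cons_val]
  rfl

/-- Swapping a finite sum with a list sum. -/
theorem sum_univ_list_sum {β : Type*} (L : List β) (g : Fin 8 → β → ℤ) :
    ∑ k : Fin 8, (L.map (g k)).sum = (L.map fun p => ∑ k : Fin 8, g k p).sum := by
  induction L with
  | nil => simp
  | cons b L ih => simp [Finset.sum_add_distrib, ih]

/-- The subtour count along a Hamiltonian cycle: for a proper non-empty vertex list `S` without repetition and a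
bijection `c : Fin 8 → Fin 8`, `#{k : c k ∈ S ∧ c (k+1) ∈ S} + 1 ≤ |S|`. -/
theorem card_cycle_edges_le (c : Equiv.Perm (Fin 8)) (S : List (Fin 8)) (hS : S.Nodup) (h0 : 0 < S.length)
    (h8 : S.length < 8) :
    ((Finset.univ.filter fun k : Fin 8 => c k ∈ S ∧ c (k + 1) ∈ S).card : ℤ) + 1 ≤ S.length := by
  set P := Finset.univ.filter fun k : Fin 8 => c k ∈ S with hP
  have hPS : P.image c = S.toFinset := by
    ext x
    simp only [Finset.mem_image, Finset.mem_filter, Finset.mem_univ, true_and, List.mem_toFinset, hP]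
    constructor
    · rintro ⟨k, hk, rfl⟩; exact hk
    · intro hx; exact ⟨c.symm x, by simpa using hx, by simp⟩
  have hcardP : P.card = S.length := by
    rw [← List.toFinset_card_of_nodup hS, ← hPS, Finset.card_image_of_injective _ c.injective]
  have hne : P.Nonempty := by
    obtain ⟨x, hx⟩ := List.exists_mem_of_length_pos h0
    exact ⟨c.symm x, by simp [hP, hx]⟩
  have hPu : P ≠ Finset.univ := by
    intro hu
    have : (Finset.univ : Finset (Fin 8)).card = S.length := by rw [← hu, hcardP]
    simp at this
    omega
  have hK : (Finset.univ.filter fun k : Fin 8 => c k ∈ S ∧ c (k + 1) ∈ S) =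
      Finset.univ.filter fun k : Fin 8 => k ∈ P ∧ k + 1 ∈ P := by
    ext k; simp [hP]
  have hlt := cyc_card_lt P hne hPu
  rw [hK, ← hcardP]
  omega

/-- **Weak duality**: under a valid Held–Karp certificate every Hamiltonian cycle `f ∘ tourSeq0` (`f` a bijection
of `Fin 8`) has `D · weight ≤ hkBound Y L`. -/
theorem tourValF_le_of_hkValid {n : Fin 8 → Fin 8 → ℤ} {D : ℕ} {Y : Fin 8 → ℤ} {L : List (List (Fin 8) × ℕ)}
    (h : hkValid n D Y L = true) (f : Equiv.Perm (Fin 8)) : (D : ℤ) * tourValF n f ≤ hkBound Y L := by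
  obtain ⟨hL, hE⟩ := hkValid_spec h
  set c : Equiv.Perm (Fin 8) := tourPerm0.trans f with hc
  have hcf : ∀ k, f (tourSeq0 k) = c k := fun k => rfl
  rw [tourValF_eq_sum, Finset.mul_sum]
  simp_rw [hcf]
  -- edge by edge
  have hk1 : ∀ k : Fin 8, k ≠ k + 1 := by decide
  have hstep : ∀ k : Fin 8,
      (D : ℤ) * tourW n (c k) (c (k + 1)) ≤ Y (c k) + Y (c (k + 1)) + hkSum L (c k) (c (k + 1)) :=
    fun k => hE _ _ fun heq => hk1 k (c.injective heq)
  refine (Finset.sum_le_sum fun k _ => hstep k).trans ?_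
  rw [Finset.sum_add_distrib, Finset.sum_add_distrib]
  have hY1 : ∑ k : Fin 8, Y (c k) = ∑ i : Fin 8, Y i := Equiv.sum_comp c Y
  have hY2 : ∑ k : Fin 8, Y (c (k + 1)) = ∑ i : Fin 8, Y i := by
    have := Equiv.sum_comp ((Equiv.addRight (1 : Fin 8)).trans c) Y
    simpa using this
  rw [hY1, hY2]
  unfold hkBound hkSum
  rw [sum_univ_list_sum]
  have hYsum : ∑ i : Fin 8, Y i = Y 0 + Y 1 + Y 2 + Y 3 + Y 4 + Y 5 + Y 6 + Y 7 := by
    simp [Fin.sum_univ_eight]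
  rw [hYsum]
  have hLle : (L.map fun p => ∑ k : Fin 8, (if c k ∈ p.1 ∧ c (k + 1) ∈ p.1 then (p.2 : ℤ) else 0)).sum ≤
      (L.map fun p => (p.2 : ℤ) * ((p.1.length : ℤ) - 1)).sum := by
    apply List.sum_le_sum
    intro p hp
    obtain ⟨hnd, h0, h8⟩ := hL p hp
    have hcnt := card_cycle_edges_le c p.1 hnd h0 h8
    have hsum : ∑ k : Fin 8, (if c k ∈ p.1 ∧ c (k + 1) ∈ p.1 then (p.2 : ℤ) else 0) =
        (p.2 : ℤ) * ((Finset.univ.filter fun k : Fin 8 => c k ∈ p.1 ∧ c (k + 1) ∈ p.1).card : ℤ) := by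
      rw [Finset.card_filter, Nat.cast_sum, Finset.mul_sum]
      refine Finset.sum_congr rfl fun k _ => ?_
      split_ifs <;> simp
    rw [hsum]
    exact mul_le_mul_of_nonneg_left (by linarith) (by positivity)
  linarith

/-- Weak duality for `σ ∈ S₇`. -/
theorem tourVal_le_of_hkValid {n : Fin 8 → Fin 8 → ℤ} {D : ℕ} {Y : Fin 8 → ℤ} {L : List (List (Fin 8) × ℕ)}
    (h : hkValid n D Y L = true) (σ : Equiv.Perm (Fin 7)) : (D : ℤ) * tourVal n σ ≤ hkBound Y L :=
  tourValF_le_of_hkValid h (liftPerm σ)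

/-- Integrality rounding: `D·t ≤ B < D·(q+1)` forces `t ≤ q`. -/
theorem le_of_mul_le_of_lt {D : ℕ} (hD : 0 < D) {t q B : ℤ} (h1 : (D : ℤ) * t ≤ B) (h2 : B < (D : ℤ) * (q + 1)) :
    t ≤ q := by
  have : (D : ℤ) * t < (D : ℤ) * (q + 1) := lt_of_le_of_lt h1 h2
  have := lt_of_mul_lt_mul_left this (by positivity)
  omega

/-- **The value of `𝒩(θ)` from a certificate**: floor table `n` off the diagonal, a valid Held–Karp certificate with
`hkBound < D(q+1)`, and a permutation attaining `q` give `torusN θ = q − tourVal n 1`. -/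
theorem torusN_eq_of_cert {θ : Fin 8 → ℝ} {n : Fin 8 → Fin 8 → ℤ} (hθ : ∀ i j, i ≠ j → floorTab θ i j = n i j)
    {D : ℕ} (hD : 0 < D) {Y : Fin 8 → ℤ} {L : List (List (Fin 8) × ℕ)} (hv : hkValid n D Y L = true) {q : ℤ}
    (hq : hkBound Y L < (D : ℤ) * (q + 1)) {σw : Equiv.Perm (Fin 7)} (hw : tourVal n σw = q) :
    torusN θ = q - tourVal n 1 := by
  have hterm : ∀ σ, torusTerm θ σ = tourVal n σ - tourVal n 1 := fun σ => by
    rw [torusTerm_eq_tourVal, tourVal_congr hθ, tourVal_congr hθ]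
  unfold torusN
  apply le_antisymm
  · refine Finset.sup'_le _ _ fun σ _ => ?_
    rw [hterm]
    have := le_of_mul_le_of_lt hD (tourVal_le_of_hkValid hv σ) hq
    linarith
  · have h := Finset.le_sup' (torusTerm θ) (Finset.mem_univ σw)
    rw [hterm, hw] at h
    exact h

end Summit.KontsevichZagierPeriods.Zeta5Search.Barrier.ConeGamma
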